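import Summits.CriticalPhenomena.PercolationContinuityZ3.Theorems.FreeBoxPowerSaving.Negative.FreeBoxPowerSavingProfile
import Summits.CriticalPhenomena.PercolationContinuityZ3.Theses.PercTwoPointDecay
import Literature.Barriers.CriticalPhenomena.LaceExpansionHighDimensionProofs

/-!
# Negative / tightness lemmas for the crux `FreeBoxPowerSaving` (stmt-CriticalPhenomena-4447), V:
# the crux is the weakest quantitative-decay statement of the cone

Cross-route bridges (cdisprove cycle 2).  With `X_A = PercTwoPointDecay.CritBallAverageDecay`
(stmt-CriticalPhenomena-0833: `Σ_{x∈B(R)} τ_{p_c}(0,x) ≤ C R^{3-a}`) and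
`PercTwoPointDecay.CritPointwiseDecay` (stmt-0836: `τ_{p_c}(0,x) ≤ C ‖x‖^{-a}`, `x ≠ 0`):

* `of_critBallAverageDecay` — **`X_A ⟹ FreeBoxPowerSaving`** (free `≤` bulk termwise, then the
  centred form `freeBoxPowerSaving_iff_centredPowerSaving` of part III with `b = 3 - a`);
* `ballSum_le_of_pointwise`, `of_critPointwiseDecay` — **`CritPointwiseDecay ⟹ X_A ⟹ crux`** (shell
  summation, `|∂Λ_k| ≤ 54 k²`; exponent `min(a,2)`);
* `not_critBallAverageDecay_of_not`, `not_critPointwiseDecay_of_not` — so a refutation of 4447 would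
  refute 0833 and 0836 at once (and, by part IV, polynomial one-arm decay): within the cone the crux
  is the WEAKEST of the quantitative critical-decay statements, which is why it resists disproof
  exactly as much as `θ(p_c) = 0` resists proof.  (For LONG-RANGE percolation on `ℤ^d` with exponent
  `α < d` the `X_A`-shape bound is a theorem — Hutchcroft, PTRF 181 (2021), Thm 1.1, second display,
  `|Λ_r|⁻¹ Σ_{Λ_r} P_{β_c}(0 ↔ x) ≤ C r^{-2(d-α)/(3d)}` — so the crux-analogue HOLDS there, while at
  `d = α = 1` it FAILS with the Aizenman–Newman discontinuity; nearest-neighbour `ℤ³` is the open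
  middle.)
-/

namespace Summit.CriticalPhenomena.PercolationContinuityZ3.FreeBoxPowerSavingNegative

open MeasureTheory ProbabilityTheory Filter
open Literature.Probability.Percolation Literature.Probability.LatticeModels
open Literature.Barriers.CriticalPhenomena (sum_box_sdiff_box_eq_sum_Ico card_sphere_succ_le')
open Summit.CriticalPhenomena.PercolationContinuityZ3.Theses.PercNonProliferation
open Summit.CriticalPhenomena.PercolationContinuityZ3.Theses.PercTwoPointDecay
  (CritBallAverageDecay CritPointwiseDecay)
open scoped BigOperators Topology

noncomputable section

/-- **`X_A ⟹ FreeBoxPowerSaving`**: a ball-summed critical two-point power saving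
`Σ_{x∈B(R)} τ_{p_c}(0,x) ≤ C R^{3-a}` (stmt-CriticalPhenomena-0833) gives the crux (exponent `a`,
through the centred free form of part III: `P(0 ↔ x in B(R)) ≤ τ(0,x)` termwise). [folklore] -/
theorem of_critBallAverageDecay (h : CritBallAverageDecay) : FreeBoxPowerSaving := by
  obtain ⟨a, C, ha, hC⟩ := h
  refine freeBoxPowerSaving_iff_centredPowerSaving.2 ⟨3 - a, C, by linarith, fun R hR => ?_⟩
  calc ∑ x ∈ box 3 R, (bondPercolation (zdGraph 3) (criticalProbI 3)).real
          (openConnIn (↑(box 3 R) : Set (Site 3)) 0 x)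
      ≤ ∑ x ∈ box 3 R, (bondPercolation (zdGraph 3) (criticalProbI 3)).real (openConn 0 x) :=
        Finset.sum_le_sum fun x _ => (real_openConnIn_le_tau (criticalProbI 3) _ 0 x).trans_eq
          (tau_def _ 0 x)
    _ ≤ C * (R : ℝ) ^ (3 - a) := hC R hR

/-- Contrapositive: refuting the crux refutes `X_A` (stmt-CriticalPhenomena-0833). [folklore] -/
theorem not_critBallAverageDecay_of_not (h : ¬ FreeBoxPowerSaving) : ¬ CritBallAverageDecay :=
  fun h' => h (of_critBallAverageDecay h')

/-- **Shell summation of a pointwise bound**: `τ_p(0,x) ≤ C ‖x‖^{-a}` for `x ≠ 0` with `a ≤ 2`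
gives `Σ_{x∈B(R)} τ_p(0,x) ≤ (1 + 54 C) R^{3-a}` for `R ≥ 1` (`‖·‖` = sup norm, `|∂Λ_k| ≤ 54 k²`;
only `a ≤ 2` is used).
[folklore] -/
theorem ballSum_le_of_pointwise (p : unitInterval) {C a : ℝ} (ha2 : a ≤ 2)
    (hC : ∀ x : Site 3, x ≠ 0 → tau 3 p 0 x ≤ C * ‖x‖ ^ (-a)) {R : ℕ} (hR : 1 ≤ R) :
    ∑ x ∈ box 3 R, tau 3 p 0 x ≤ (1 + 54 * C) * (R : ℝ) ^ (3 - a) := by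
  classical
  have hR1 : (1 : ℝ) ≤ R := by exact_mod_cast hR
  have hR0 : (0 : ℝ) < R := by linarith
  have hRpow1 : 1 ≤ (R : ℝ) ^ (3 - a) := Real.one_le_rpow hR1 (by linarith)
  -- `C ≥ 0` (test the hypothesis at `e₀`)
  have hC0 : 0 ≤ C := by
    have hx : (Pi.single 0 1 : Site 3) ≠ 0 := by
      intro h
      have := congr_fun h 0
      simp at this
    have h1 := hC _ hx
    have hnorm : ‖(Pi.single 0 1 : Site 3)‖ = 1 := by
      rw [Pi.norm_single]; simp
    rw [hnorm, Real.one_rpow, mul_one] at h1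
    exact (tau_nonneg p 0 _).trans h1
  -- pointwise bound in terms of the integer sup norm
  have hpt : ∀ x ∈ box 3 R \ box 3 0, tau 3 p 0 x ≤ C * ((Site.supNorm x : ℕ) : ℝ) ^ (-a) := by
    intro x hx
    obtain ⟨-, hx0⟩ := Finset.mem_sdiff.1 hx
    have hx0' : x ≠ 0 := by
      intro h
      apply hx0
      rw [h]
      exact zero_mem_box 3 0
    have h := hC x hx0'
    rwa [Site.norm_eq_supNorm] at h
  have hsplit : ∑ x ∈ box 3 R, tau 3 p 0 x =
      ∑ x ∈ box 3 R \ box 3 0, tau 3 p 0 x + ∑ x ∈ box 3 0, tau 3 p 0 x :=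
    (Finset.sum_sdiff (box_mono 3 (Nat.zero_le R))).symm
  have hzero : ∑ x ∈ box 3 0, tau 3 p 0 x ≤ 1 := by
    calc ∑ x ∈ box 3 0, tau 3 p 0 x ≤ ∑ _x ∈ box 3 0, (1 : ℝ) :=
          Finset.sum_le_sum fun x _ => tau_le_one p 0 x
      _ = 1 := by rw [Finset.sum_const, card_box, nsmul_eq_mul]; norm_num
  have hshell : ∀ k ∈ Finset.Ico 0 R,
      ((sphere 3 (k + 1)).card : ℝ) * (C * (((k + 1 : ℕ) : ℝ) ^ (-a))) ≤ 54 * C * (R : ℝ) ^ (2 - a) := by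
    intro k hk
    have hkR : k + 1 ≤ R := (Finset.mem_Ico.1 hk).2
    have hk1 : (0 : ℝ) < (k : ℝ) + 1 := by positivity
    have hkR' : (k : ℝ) + 1 ≤ R := by exact_mod_cast hkR
    have hcard : ((sphere 3 (k + 1)).card : ℝ) ≤ 54 * ((k : ℝ) + 1) ^ 2 := by
      have h := card_sphere_succ_le' (d := 3) (by norm_num) k
      norm_num at h
      linarith
    have hpow : ((k : ℝ) + 1) ^ 2 * ((k : ℝ) + 1) ^ (-a) = ((k : ℝ) + 1) ^ (2 - a) := by
      rw [← Real.rpow_two, ← Real.rpow_add hk1, show (2 : ℝ) + -a = 2 - a by ring]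
    push_cast
    calc ((sphere 3 (k + 1)).card : ℝ) * (C * ((k : ℝ) + 1) ^ (-a))
        ≤ 54 * ((k : ℝ) + 1) ^ 2 * (C * ((k : ℝ) + 1) ^ (-a)) :=
          mul_le_mul_of_nonneg_right hcard (mul_nonneg hC0 (Real.rpow_nonneg hk1.le _))
      _ = 54 * C * (((k : ℝ) + 1) ^ 2 * ((k : ℝ) + 1) ^ (-a)) := by ring
      _ = 54 * C * ((k : ℝ) + 1) ^ (2 - a) := by rw [hpow]
      _ ≤ 54 * C * (R : ℝ) ^ (2 - a) :=
          mul_le_mul_of_nonneg_left (Real.rpow_le_rpow hk1.le hkR' (by linarith)) (by positivity)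
  have hmul : (R : ℝ) * (R : ℝ) ^ (2 - a) = (R : ℝ) ^ (3 - a) := by
    rw [show (3 : ℝ) - a = 1 + (2 - a) by ring, Real.rpow_add hR0, Real.rpow_one]
  have hann : ∑ x ∈ box 3 R \ box 3 0, tau 3 p 0 x ≤ 54 * C * (R : ℝ) ^ (3 - a) := by
    calc ∑ x ∈ box 3 R \ box 3 0, tau 3 p 0 x
        ≤ ∑ x ∈ box 3 R \ box 3 0, C * ((Site.supNorm x : ℕ) : ℝ) ^ (-a) := Finset.sum_le_sum hpt
      _ = ∑ x ∈ box 3 R \ box 3 0, (fun k : ℕ => C * (k : ℝ) ^ (-a)) (Site.supNorm x) := rfl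
      _ = ∑ k ∈ Finset.Ico 0 R, ((sphere 3 (k + 1)).card : ℝ) * (C * (((k + 1 : ℕ) : ℝ) ^ (-a))) := by
          rw [sum_box_sdiff_box_eq_sum_Ico (fun k : ℕ => C * (k : ℝ) ^ (-a)) (Nat.zero_le R)]
      _ ≤ ∑ _k ∈ Finset.Ico 0 R, 54 * C * (R : ℝ) ^ (2 - a) := Finset.sum_le_sum hshell
      _ = (R : ℝ) * (54 * C * (R : ℝ) ^ (2 - a)) := by
          rw [Finset.sum_const, Nat.card_Ico, nsmul_eq_mul, Nat.sub_zero]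
      _ = 54 * C * ((R : ℝ) * (R : ℝ) ^ (2 - a)) := by ring
      _ = 54 * C * (R : ℝ) ^ (3 - a) := by rw [hmul]
  calc ∑ x ∈ box 3 R, tau 3 p 0 x
      = ∑ x ∈ box 3 R \ box 3 0, tau 3 p 0 x + ∑ x ∈ box 3 0, tau 3 p 0 x := hsplit
    _ ≤ 54 * C * (R : ℝ) ^ (3 - a) + 1 := add_le_add hann hzero
    _ ≤ 54 * C * (R : ℝ) ^ (3 - a) + 1 * (R : ℝ) ^ (3 - a) := by nlinarith
    _ = (1 + 54 * C) * (R : ℝ) ^ (3 - a) := by ring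

/-- **`CritPointwiseDecay ⟹ X_A`** (stmt-0836 ⟹ stmt-0833), with exponent `min(a, 2)`. [folklore] -/
theorem critBallAverageDecay_of_critPointwiseDecay (h : CritPointwiseDecay) : CritBallAverageDecay := by
  obtain ⟨a, C, ha, hC⟩ := h
  have ha' : 0 < min a 2 := lt_min ha two_pos
  refine ⟨min a 2, 1 + 54 * max C 0, ha', fun R hR => ?_⟩
  have h := ballSum_le_of_pointwise (criticalProbI 3) (C := max C 0) (a := min a 2) (min_le_right _ _) ?_ hR
  · simpa only [tau_def] using h
  · intro x hx
    have hx1 : (1 : ℝ) ≤ ‖x‖ := by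
      rw [Site.norm_eq_supNorm]
      have : 1 ≤ Site.supNorm x := by
        by_contra h0
        push Not at h0
        exact hx (Site.supNorm_eq_zero_iff.1 (by omega))
      exact_mod_cast this
    calc tau 3 (criticalProbI 3) 0 x ≤ C * ‖x‖ ^ (-a) := hC x hx
      _ ≤ max C 0 * ‖x‖ ^ (-a) :=
          mul_le_mul_of_nonneg_right (le_max_left _ _) (Real.rpow_nonneg (by positivity) _)
      _ ≤ max C 0 * ‖x‖ ^ (-min a 2) :=
          mul_le_mul_of_nonneg_left
            (Real.rpow_le_rpow_of_exponent_le hx1 (neg_le_neg (min_le_left a 2))) (le_max_right _ _)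

/-- **`CritPointwiseDecay ⟹ FreeBoxPowerSaving`** (stmt-0836 ⟹ stmt-4447). [folklore] -/
theorem of_critPointwiseDecay (h : CritPointwiseDecay) : FreeBoxPowerSaving :=
  of_critBallAverageDecay (critBallAverageDecay_of_critPointwiseDecay h)

/-- Contrapositive: refuting the crux refutes `CritPointwiseDecay` (stmt-CriticalPhenomena-0836). [folklore] -/
theorem not_critPointwiseDecay_of_not (h : ¬ FreeBoxPowerSaving) : ¬ CritPointwiseDecay :=
  fun h' => h (of_critPointwiseDecay h')

end

end Summit.CriticalPhenomena.PercolationContinuityZ3.FreeBoxPowerSavingNegative
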